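import Literature.Computability.Complexity.UniformDerandomizationRandAlg
import Literature.Computability.Complexity.FoldBricks
import Literature.Computability.Complexity.PlumbingBricks
import Literature.Computability.Complexity.FPStringBricks
import Literature.Computability.Complexity.StackBricksStrings
import Literature.Computability.Complexity.MajorityEnumeration
import Literature.Computability.Complexity.BPPErrorReduction
import HarnessLib

/-!
# The two renderings of Impagliazzo–Wigderson 1998 are equivalent
# (samplers with bounded coin budgets reduce to uniform samplers)

Literature / complexity — companion to `UniformDerandomization.lean` (the named fact
`impagliazzoWigderson1998_samplable`, van Melkebeek 2000, Thm. 6.2.1 = Impagliazzo–Wigderson 1998,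
Thm. 5, over the tree's sampler class `Ensemble.IsPolySamplable`: polynomial-time `run`, coin budget
only polynomially BOUNDED) and `UniformDerandomizationRandAlg.lean` (the named fact
`impagliazzoWigderson1998` over the PRINTED sampler class: coin budget exactly a polynomial, and the
proof `impagliazzoWigderson1998_of_samplable` that the tree's rendering implies the printed one).

This file proves the CONVERSE, **`impagliazzoWigderson1998_samplable_of_printed :
impagliazzoWigderson1998 → impagliazzoWigderson1998_samplable`**, so the two named facts are
EQUIVALENT and the tree's rendering carries no strength beyond the printed theorem. The point
(`UniformDerandomizationRandAlg.lean`, module docstring) was that a bounded but otherwise arbitrary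
budget `coinLen m ≤ p(m)` hands the sampler `O(log m)` bits of advice per length. Such advice is
harmless for a conclusion that is only asked infinitely often and with every inverse-polynomial
slack: a UNIFORM sampler guesses the advice.

## The reduction (folklore; the quantifier bookkeeping of Trevisan–Vadhan 2007, §2.1/Lemma 2.3)

Fix the language `B` given by the printed theorem for `A` and `ε`. Let `D` be sampled by a
probabilistic polynomial-time `S` with `S.coinLen m ≤ p(m)`, length-preserving on its support, and
suppose `Pr_{D_m}[A ≠ B] ≥ m^{-d}` for all large `m`. The uniform sampler `UDerand.mixSampler S p`
(exact budget `2p(m) + 1` coins) reads `L(m) = |bin p(m)| + 1` coins as a number `v`, sets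
`j = min(v, p(m))` (`Brick.binToUnaryFn`), runs `S(1^m; ·)` on the next `j` coins and outputs the
result padded/truncated to length `m` (`List.takeD m · false`, the identity on the support). With probability `2^{-L(m)} ≥ 1/(4 p(m) + 4)` it guesses
`j = S.coinLen m`, in which case its output is distributed as `D_m`; hence
`Pr_{mix}[A ≠ B] ≥ m^{-d} / (4 p(m) + 4) ≥ m^{-d'}` for all large `m`
(`UDerand.pr_mixSampler_ge`), contradicting the printed theorem for the uniform sampler `mix` and
the constant `d'`.

## Contents

* `UDerand.sampleFn S` — the sampler as a total string function `⟨1ⁿ, u⟩ ↦ S(1ⁿ; u)`, in `FP` for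
  a PPT sampler (`UDerand.sampleFn_mem_FP`: `PolyTimeComputable.comp_holds` with the normaliser
  `z ↦ ⟨1^{|z₁|}, z₂⟩`);
* `UDerand.mixSampler S p`, `mixSampler_isPolyTime`, `mixSampler_coinLen_eq`, `length_mixSampler_run`,
  `UDerand.pr_mixSampler_ge` (the `2^{-L}` lower bound);
* `impagliazzoWigderson1998_samplable_of_printed`, `impagliazzoWigderson1998_samplable_iff_printed`.

## References

* D. van Melkebeek, *Randomness and Completeness in Computational Complexity*, LNCS 1950 (2000),
  Thm. 6.2.1 [VanMelkebeek2000].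
* R. Impagliazzo, A. Wigderson, *Randomness vs time: derandomization under a uniform assumption*,
  JCSS 63 (2001) 672–688 (FOCS 1998), Thm. 5 and Def. 1 [ImpagliazzoWigderson2001].
* L. Trevisan, S. Vadhan, *Pseudorandomness and average-case complexity via uniform reductions*,
  Comput. Complexity 16 (2007), §2.1 (`PSamp`, `HeurTIME` vs `PseudoTIME`) [TrevisanVadhan2007].
* S. Arora, B. Barak, *Computational Complexity: A Modern Approach*, CUP 2009, §7.1, Def. 7.3
  [AroraBarakCC2009].
-/

noncomputable section

namespace Literature.Computability.Complexity

open _root_.Computability Finset Filter Polynomial Brick Plumb MetaComplexity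

namespace UDerand

/-! ### Small lemmas -/

/-- `|1^m| = m` for Mathlib's unary numerals (private copy; the tree's public copies live in unrelated
heavy files, e.g. `MetaComplexity/GapMINKTSearchProofs.lean`). [folklore] -/
private theorem length_unaryEncodeNat (m : ℕ) : (unaryEncodeNat m).length = m := by
  rw [OracleCompose.unaryEncodeNat_eq_replicate, List.length_replicate]

/-- A single string of the right length is counted once (private copy of `ToranCH.cnt_singleton` of
`ToranCounting.lean`, whose import closure — Toda's theorem — does not belong here). [folklore] -/
private theorem cnt_singleton (w : List Bool) : cnt w.length {w} = 1 := by
  classical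
  unfold cnt
  rw [card_eq_one]
  refine ⟨⟨w, rfl⟩, ?_⟩
  ext r
  simp only [mem_filter, mem_univ, true_and, Set.mem_singleton_iff, mem_singleton]
  constructor
  · intro h; exact List.Vector.eq _ _ h
  · rintro rfl; rfl

/-- `2^{|bin P| + 1} ≤ 4 (P + 1)`. [folklore] -/
theorem two_pow_length_encodeNat_succ_le (P : ℕ) : 2 ^ ((encodeNat P).length + 1) ≤ 4 * (P + 1) := by
  rw [TM2Pass.length_encodeNat_eq_size]
  rcases Nat.eq_zero_or_pos P with rfl | hP
  · simp
  · have hs : 0 < P.size := Nat.size_pos.2 hP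
    have h1 : 2 ^ (P.size - 1) ≤ P := Nat.lt_size.1 (by omega)
    have h2 : 2 ^ (P.size + 1) = 2 ^ (P.size - 1) * 4 := by
      rw [show P.size + 1 = (P.size - 1) + 2 by omega, pow_add]; norm_num
    rw [h2]; omega

/-! ### The sampler as a string function -/

/-- The sampler as a total string function `⟨1ⁿ, u⟩ ↦ S(1ⁿ; u)` (reading `n` as the length of the
first component). [folklore] -/
def sampleFn (S : RandAlg ℕ (List Bool)) : List Bool → List Bool := fun z => S.run (fstF z).length (sndF z)

/-- **The sampler's string function is in `FP`** when the sampler is probabilistic polynomial time: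
`sampleFn = uncurry S.run ∘ (z ↦ (|z₁|, z₂))`, and the inner map, read through the sampler's input
encoding `(n, u) ↦ ⟨1ⁿ, u⟩`, is the `FP` normaliser `z ↦ ⟨1^{|z₁|}, z₂⟩`
(`PolyTimeComputable.comp_holds`). [cite: AroraBarakCC2009, §1.3 (composition)] -/
theorem sampleFn_mem_FP {S : RandAlg ℕ (List Bool)} (hS : S.IsPolyTime unaryEncodeNat id) :
    sampleFn S ∈ FP := by
  have hnorm : (fanoutFn (onesFn ∘ fstF) sndF) ∈ FP :=
    fanoutFn_mem_FP (comp_mem_FP onesFn_mem_FP fstF_mem_FP) sndF_mem_FP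
  have hf : PolyTimeComputable (id : List Bool → List Bool)
      (fun p : ℕ × List Bool => boolPair (unaryEncodeNat p.1) p.2)
      (fun z : List Bool => ((fstF z).length, sndF z)) := by
    obtain ⟨p, M, hM⟩ := hnorm
    refine ⟨p, M, fun z => ?_⟩
    have := hM z
    simpa [fanoutFn_apply, onesFn] using this
  exact PolyTimeComputable.comp_holds hS.1 hf

/-! ### The uniform sampler guessing the coin budget -/

section Mix

variable (S : RandAlg ℕ (List Bool)) (p : Polynomial ℕ)

/-- The number of coins read as the guess: `L(m) = |bin p(m)| + 1`. [folklore] -/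
def guessLen (m : ℕ) : ℕ := (encodeNat (p.eval m)).length + 1

/-- **The uniform sampler `mix`**: with coins `r` (exactly `2 p(m) + 1` of them) on `1^m`, read
`v = ⟦r ↾ L(m)⟧`, set `j = min(v, p(m))`, run `S(1^m; ·)` on the next `j` coins and output the
result padded/truncated to length `m` (`List.takeD m · false`; the identity on strings of length `m`).
[folklore] -/
def mixSampler : RandAlg ℕ (List Bool) where
  run m r := List.takeD m
    (S.run m ((r.drop (guessLen p m)).take (min (bitsToNat (r.take (guessLen p m))) (p.eval m)))) false
  coinLen m := (2 * p + 1).eval m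

/-- `mix` tosses exactly `(2p + 1)(m)` coins. [folklore] -/
theorem mixSampler_coinLen_eq : ∀ m, (mixSampler S p).coinLen m = (2 * p + 1).eval m := fun _ => rfl

/-- `mix` is length-preserving on every coin string. [folklore] -/
theorem length_mixSampler_run (m : ℕ) (r : List Bool) : ((mixSampler S p).run m r).length = m :=
  List.takeD_length _ _ _

/-! #### `mix` is probabilistic polynomial time -/

/-- On `z = ⟨1^m, r⟩`: `1^{p(m)}`. [folklore] -/
def PUF : List Bool → List Bool := polyFn p ∘ fstF

/-- On `z`: `1^{L(m)}`. [folklore] -/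
def LUF : List Bool → List Bool := List.cons true ∘ onesFn ∘ lenBinF ∘ PUF p

/-- On `z`: the guess in unary `1^{min(⟦r↾L⟧, p(m))}`. [folklore] -/
def jUF : List Bool → List Bool := binToUnaryFn ∘ fanoutFn (PUF p) (takeFn ∘ fanoutFn (LUF p) sndF)

/-- On `z`: the coins handed to `S`, `(r ⇂ L) ↾ j`. [folklore] -/
def uF' : List Bool → List Bool := takeFn ∘ fanoutFn (jUF p) (dropFn ∘ fanoutFn (LUF p) sndF)

/-- On `z`: the sample `x = S(1^m; u)`. [folklore] -/
def xF' : List Bool → List Bool := sampleFn S ∘ fanoutFn fstF (uF' p)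

/-- **`mix` as a string function**: the sample padded/truncated to length `m` (`padTakeFn`). [folklore] -/
def mixF : List Bool → List Bool := fstF ∘ padTakeFn ∘ fanoutFn fstF (xF' S p)

variable {S}

/-- `mixF ∈ FP` for a PPT sampler. [cite: AroraBarakCC2009, §1.3 (composition)] -/
theorem mixF_mem_FP (hS : S.IsPolyTime unaryEncodeNat id) : mixF S p ∈ FP := by
  have hP : PUF p ∈ FP := comp_mem_FP (polyFn_mem_FP p) fstF_mem_FP
  have hL : LUF p ∈ FP := comp_mem_FP (cons_mem_FP true) (comp_mem_FP onesFn_mem_FP (comp_mem_FP lenBinF_mem_FP hP))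
  have hj : jUF p ∈ FP :=
    comp_mem_FP binToUnaryFn_mem_FP (fanoutFn_mem_FP hP (comp_mem_FP takeFn_mem_FP (fanoutFn_mem_FP hL sndF_mem_FP)))
  have hu : uF' p ∈ FP :=
    comp_mem_FP takeFn_mem_FP (fanoutFn_mem_FP hj (comp_mem_FP dropFn_mem_FP (fanoutFn_mem_FP hL sndF_mem_FP)))
  have hx : xF' S p ∈ FP := comp_mem_FP (sampleFn_mem_FP hS) (fanoutFn_mem_FP fstF_mem_FP hu)
  exact comp_mem_FP fstF_mem_FP (comp_mem_FP padTakeFn_mem_FP (fanoutFn_mem_FP fstF_mem_FP hx))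

variable (S)

/-- **Value of `mixF`** on `⟨1^m, r⟩`: the run of `mix`. [folklore] -/
theorem mixF_boolPair (m : ℕ) (r : List Bool) :
    mixF S p (boolPair (unaryEncodeNat m) r) = (mixSampler S p).run m r := by
  have hm : (unaryEncodeNat m).length = m := length_unaryEncodeNat m
  obtain ⟨j, hjdef⟩ : ∃ j, j = min (bitsToNat (r.take (guessLen p m))) (p.eval m) := ⟨_, rfl⟩
  have hP : PUF p (boolPair (unaryEncodeNat m) r) = ones (p.eval m) := by
    simp only [PUF, Function.comp_apply, fstF_boolPair, polyFn_apply, hm]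
  have hL : LUF p (boolPair (unaryEncodeNat m) r) = ones (guessLen p m) := by
    simp only [LUF, Function.comp_apply, hP, lenBinF_apply, onesFn]
    rw [OracleCompose.unaryEncodeNat_eq_replicate, guessLen]
    simp [ones, List.replicate_succ]
  have hj : jUF p (boolPair (unaryEncodeNat m) r) = ones j := by
    simp only [jUF, Function.comp_apply, fanoutFn_apply, hP, hL, takeFn_boolPair, sndF_boolPair,
      binToUnaryFn_boolPair, hjdef]
    simp [ones]
  have hu : uF' p (boolPair (unaryEncodeNat m) r) = (r.drop (guessLen p m)).take j := by
    simp only [uF', Function.comp_apply, fanoutFn_apply, hj, hL, takeFn_boolPair, dropFn_boolPair, sndF_boolPair]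
    simp [ones]
  have hx : xF' S p (boolPair (unaryEncodeNat m) r) = S.run m ((r.drop (guessLen p m)).take j) := by
    simp only [xF', Function.comp_apply, fanoutFn_apply, fstF_boolPair, hu, sampleFn, sndF_boolPair, hm]
  have hrun : (mixSampler S p).run m r = List.takeD m (S.run m ((r.drop (guessLen p m)).take j)) false := by
    dsimp only [mixSampler]
    rw [← hjdef]
  rw [hrun, mixF]
  simp only [Function.comp_apply, fanoutFn_apply, fstF_boolPair, hx, padTakeFn_boolPair, hm]

variable {S}

/-- **`mix` is a PPT sampler** (and its budget is exactly the polynomial `2p + 1`).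
[cite: AroraBarakCC2009, Def. 7.3] -/
theorem mixSampler_isPolyTime (hS : S.IsPolyTime unaryEncodeNat id) :
    (mixSampler S p).IsPolyTime unaryEncodeNat (id : List Bool → List Bool) := by
  refine ⟨?_, ⟨2 * p + 1, fun n => le_rfl⟩⟩
  obtain ⟨q, M, hM⟩ := mixF_mem_FP p hS
  refine ⟨q, M, fun z => ?_⟩
  have := hM (boolPair (unaryEncodeNat z.1) z.2)
  rwa [id, mixF_boolPair] at this

/-! #### The lower bound: guessing the budget -/

/-- The coin strings on which `mix` guesses the budget `c` and hands `S` coins from `U`: first `L`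
coins the pattern `natBits L c`, next `c` coins in `U`. Their number among the strings of length
`L + (c + e)` is `cnt c U · 2^e`. [cite: AroraBarakCC2009, §7.1 (independent coin blocks)] -/
theorem cnt_guess (L c e : ℕ) (U : Set (List Bool)) :
    cnt (L + (c + e)) {r | r.take L = natBits L c ∧ (r.drop L).take c ∈ U} = cnt c U * 2 ^ e := by
  have h := cnt_take_drop L (c + e) {natBits L c} {z | z.take c ∈ U ∧ z.drop c ∈ (Set.univ : Set (List Bool))}
  rw [cnt_take_drop c e U Set.univ, cnt_univ, show ({natBits L c} : Set (List Bool)) = {natBits L c} from rfl] at h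
  have h1 : cnt L {natBits L c} = 1 := by
    have := cnt_singleton (natBits L c); rwa [length_natBits] at this
  rw [h1, one_mul] at h
  rw [← h]
  refine cnt_congr fun y _ => ?_
  simp only [Set.mem_setOf_eq, Set.mem_singleton_iff, Set.mem_univ, and_true]

variable (S)

/-- **Guessing the budget costs a factor `2^{-L(m)}`**: if `S` uses `c ≤ p(m)` coins on `1^m` and is
length-preserving there, then for every event `E`,
`Pr_r[mix(1^m; r) ∈ E] ≥ 2^{-L(m)} · Pr_u[S(1^m; u) ∈ E]`. [folklore] -/
theorem pr_mixSampler_ge (m : ℕ) (hc : S.coinLen m ≤ p.eval m)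
    (hlenS : ∀ u : List Bool, u.length = S.coinLen m → (S.run m u).length = m) (E : Set (List Bool)) :
    uniformProb (S.coinLen m) {u | S.run m u ∈ E} / 2 ^ guessLen p m ≤
      uniformProb ((2 * p + 1).eval m) {r | (mixSampler S p).run m r ∈ E} := by
  have hLP : guessLen p m ≤ p.eval m + 1 := by
    rw [guessLen, TM2Pass.length_encodeNat_eq_size]
    have h := Nat.size_le.2 (Nat.lt_two_pow_self (n := p.eval m))
    have : (p.eval m).size ≤ p.eval m := by
      rcases Nat.eq_zero_or_pos (p.eval m) with h0 | hpos
      · rw [h0]; rfl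
      · exact Nat.size_le.2 Nat.lt_two_pow_self |>.trans le_rfl
    omega
  have hcL : S.coinLen m < 2 ^ guessLen p m := by
    rw [guessLen]
    calc S.coinLen m ≤ p.eval m := hc
      _ = bitsToNat (encodeNat (p.eval m)) := (bitsToNat_encodeNat _).symm
      _ < 2 ^ (encodeNat (p.eval m)).length := bitsToNat_lt _
      _ ≤ 2 ^ ((encodeNat (p.eval m)).length + 1) := Nat.pow_le_pow_right two_pos (Nat.le_succ _)
  -- the total budget splits as `L + (c + e)`
  obtain ⟨e, he⟩ : ∃ e, (2 * p + 1).eval m = guessLen p m + (S.coinLen m + e) := by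
    refine ⟨(2 * p + 1).eval m - guessLen p m - S.coinLen m, ?_⟩
    have : (2 * p + 1).eval m = 2 * p.eval m + 1 := by simp
    omega
  rw [he]
  -- the guessing strings lead `mix` to output `S(1^m; u)` with `u ∈ U`
  have hsub : cnt (guessLen p m + (S.coinLen m + e))
      {r | r.take (guessLen p m) = natBits (guessLen p m) (S.coinLen m) ∧
        (r.drop (guessLen p m)).take (S.coinLen m) ∈ {u | S.run m u ∈ E}} ≤
      cnt (guessLen p m + (S.coinLen m + e)) {r | (mixSampler S p).run m r ∈ E} := by
    classical
    unfold cnt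
    refine card_le_card fun r hr => ?_
    simp only [mem_filter, mem_univ, true_and, Set.mem_setOf_eq] at hr ⊢
    obtain ⟨h1, h2⟩ := hr
    have hj : min (bitsToNat (r.toList.take (guessLen p m))) (p.eval m) = S.coinLen m := by
      rw [h1, bitsToNat_natBits hcL, min_eq_left hc]
    have hulen : ((r.toList.drop (guessLen p m)).take (S.coinLen m)).length = S.coinLen m := by
      rw [List.length_take, List.length_drop, r.toList_length]; omega
    have hrun : (mixSampler S p).run m r.toList = S.run m ((r.toList.drop (guessLen p m)).take (S.coinLen m)) := by
      dsimp only [mixSampler]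
      rw [hj, List.takeD_eq_take _ (hlenS _ hulen).ge, List.take_of_length_le (hlenS _ hulen).le]
    rw [hrun]
    exact h2
  have h := cnt_guess (guessLen p m) (S.coinLen m) e {u | S.run m u ∈ E}
  have hsub' : ((cnt (S.coinLen m) {u | S.run m u ∈ E} * 2 ^ e : ℕ) : ℝ) ≤
      cnt (guessLen p m + (S.coinLen m + e)) {r | (mixSampler S p).run m r ∈ E} := by
    rw [← h]; exact_mod_cast hsub
  push_cast at hsub'
  rw [uniformProb_eq_cnt_div, uniformProb_eq_cnt_div, div_div]
  have h2 : (2 : ℝ) ^ (guessLen p m + (S.coinLen m + e)) = 2 ^ S.coinLen m * 2 ^ guessLen p m * 2 ^ e := by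
    rw [pow_add, pow_add]; ring
  have he0 : (2 : ℝ) ^ e ≠ 0 := pow_ne_zero _ two_ne_zero
  rw [h2, ← mul_div_mul_right _ (2 ^ S.coinLen m * 2 ^ guessLen p m) he0]
  exact div_le_div_of_nonneg_right hsub' (by positivity)

end Mix

/-! ### The output law of a sampler, and its support -/

/-- The ensemble's probability is the sampler's: `D.prob m E = Pr_u[S(1^m; u) ∈ E]` over
`u ∈ {0,1}^{S.coinLen m}`. [cite: AroraBarakCC2009, §7.1] -/
theorem prob_eq_uniformProb_of_sampler {D : Ensemble} {S : RandAlg ℕ (List Bool)}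
    (hSD : ∀ n, S.outputPMF unaryEncodeNat n = D n) (m : ℕ) (E : Set (List Bool)) :
    D.prob m E = uniformProb (S.coinLen m) {u | S.run m u ∈ E} := by
  have h := RandAlg.pr_eq_uniformProb S unaryEncodeNat m E
  rw [length_unaryEncodeNat] at h
  rw [Ensemble.prob, ← hSD m]
  exact h

/-- Every run of the sampler on a coin string of the budgeted length is in the support of the
ensemble. [folklore] -/
theorem run_mem_support {D : Ensemble} {S : RandAlg ℕ (List Bool)}
    (hSD : ∀ n, S.outputPMF unaryEncodeNat n = D n) (m : ℕ) (u : List Bool) (hu : u.length = S.coinLen m) :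
    S.run m u ∈ (D m).support := by
  rw [← hSD m, RandAlg.outputPMF, PMF.mem_support_map_iff]
  refine ⟨⟨u, by rw [length_unaryEncodeNat]; exact hu⟩, PMF.mem_support_uniformOfFintype _, rfl⟩

end UDerand

/-! ### The equivalence -/

open UDerand in
/-- **The printed rendering implies the tree's rendering**: `impagliazzoWigderson1998 →
impagliazzoWigderson1998_samplable`. Given `B` from the printed theorem, a polynomial-time sampler
`S` with coin budget `≤ p(m)` whose ensemble defeats `B` at rate `m^{-d}` for all large `m` yields the
UNIFORM sampler `mixSampler S p` (exact budget `2p + 1`, length-preserving) defeating `B` at rate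
`m^{-d} · 2^{-L(m)} ≥ m^{-(d + k_p + 1)}` for all large `m` (`pr_mixSampler_ge`; `2^{L} ≤ 4(p(m)+1) ≤
m^{k_p + 1}`), which the printed theorem forbids. Together with `impagliazzoWigderson1998_of_samplable`
the two named facts are equivalent (`impagliazzoWigderson1998_samplable_iff_printed`).
[cite: VanMelkebeek2000, Thm. 6.2.1] [cite: ImpagliazzoWigderson2001, Thm. 5 and Def. 1]
[cite: TrevisanVadhan2007, §2.1] -/
theorem impagliazzoWigderson1998_samplable_of_printed (h : impagliazzoWigderson1998) :
    impagliazzoWigderson1998_samplable := by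
  intro hne A hA ε hε
  obtain ⟨B, hB, hagree⟩ := h hne A hA ε hε
  refine ⟨B, hB, fun d D hD hlen => ?_⟩
  obtain ⟨S, hS, hSD⟩ := hD
  obtain ⟨p, hp⟩ := hS.2
  obtain ⟨cp, kp, hcp⟩ := exists_eval_le_mul_pow_add p
  by_contra hnot
  rw [Filter.not_frequently] at hnot
  have key := hagree (d + kp + 1) (mixSampler S p) (mixSampler_isPolyTime p hS)
    ⟨2 * p + 1, mixSampler_coinLen_eq S p⟩ (fun m r _ => length_mixSampler_run S p m r)
  -- for all large `m`, `mix` defeats `B` at rate `m^{-(d + kp + 1)}`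
  have hev : ∀ᶠ m : ℕ in atTop,
      ¬ (1 - 1 / (m : ℝ) ^ (d + kp + 1) < (mixSampler S p).pr unaryEncodeNat m {x | x ∈ A ↔ x ∈ B}) := by
    filter_upwards [hnot, eventually_ge_atTop (8 * cp + 8)] with m hm hm8
    rw [not_lt] at hm ⊢
    set Fset : Set (List Bool) := {x | ¬ (x ∈ A ↔ x ∈ B)} with hF
    have hcompl : ({x | x ∈ A ↔ x ∈ B} : Set (List Bool)) = Fsetᶜ := by
      ext x; simp [hF]
    -- the ensemble's failure probability `δ ≥ m^{-d}`
    have hδ : 1 / (m : ℝ) ^ d ≤ uniformProb (S.coinLen m) {u | S.run m u ∈ Fset} := by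
      have h1 := prob_eq_uniformProb_of_sampler hSD m {x | x ∈ A ↔ x ∈ B}
      have h2 : uniformProb (S.coinLen m) {u | S.run m u ∈ {x | x ∈ A ↔ x ∈ B}} =
          1 - uniformProb (S.coinLen m) {u | S.run m u ∈ Fset} := by
        rw [← uniformProb_compl]
        congr 1
        ext u
        simp [hF]
      rw [h1, h2] at hm
      linarith
    -- `mix` inherits it up to the factor `2^{-L}`
    have hlenS : ∀ u : List Bool, u.length = S.coinLen m → (S.run m u).length = m :=
      fun u hu => hlen m _ (run_mem_support hSD m u hu)
    have hmix := pr_mixSampler_ge S p m (hp m) hlenS Fset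
    have hprmix : (mixSampler S p).pr unaryEncodeNat m {x | x ∈ A ↔ x ∈ B} =
        1 - uniformProb ((2 * p + 1).eval m) {r | (mixSampler S p).run m r ∈ Fset} := by
      rw [RandAlg.pr_eq_uniformProb, length_unaryEncodeNat, ← uniformProb_compl]
      show uniformProb ((mixSampler S p).coinLen m) _ = _
      rw [mixSampler_coinLen_eq]
      congr 1
      ext r
      simp [hF]
    rw [hprmix]
    -- arithmetic: `1/m^{d+kp+1} ≤ δ / 2^L`
    have hm1 : 1 ≤ m := by omega
    have hmR : (1 : ℝ) ≤ m := by exact_mod_cast hm1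
    have h2L : (2 : ℝ) ^ guessLen p m ≤ 4 * (((p.eval m : ℕ) : ℝ) + 1) := by
      have := two_pow_length_encodeNat_succ_le (p.eval m)
      rw [guessLen]; exact_mod_cast this
    have h4P : 4 * (((p.eval m : ℕ) : ℝ) + 1) ≤ (m : ℝ) ^ (kp + 1) := by
      have h1 : p.eval m ≤ cp * m ^ kp + cp := hcp m
      have h2 : 1 ≤ m ^ kp := Nat.one_le_pow _ _ hm1
      have h3 : 4 * (p.eval m + 1) ≤ m ^ (kp + 1) := by
        calc 4 * (p.eval m + 1) ≤ 4 * (cp * m ^ kp + cp + 1) := by omega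
          _ ≤ (8 * cp + 8) * m ^ kp := by nlinarith
          _ ≤ m * m ^ kp := Nat.mul_le_mul_right _ hm8
          _ = m ^ (kp + 1) := by ring
      exact_mod_cast h3
    have hpos : (0 : ℝ) < (m : ℝ) ^ d := by positivity
    have hL0 : (0 : ℝ) < 2 ^ guessLen p m := by positivity
    calc 1 - uniformProb ((2 * p + 1).eval m) {r | (mixSampler S p).run m r ∈ Fset}
        ≤ 1 - uniformProb (S.coinLen m) {u | S.run m u ∈ Fset} / 2 ^ guessLen p m := by linarith
      _ ≤ 1 - (1 / (m : ℝ) ^ d) / 2 ^ guessLen p m := by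
          gcongr
      _ ≤ 1 - 1 / (m : ℝ) ^ (d + kp + 1) := by
          have : 1 / (m : ℝ) ^ (d + kp + 1) ≤ (1 / (m : ℝ) ^ d) / 2 ^ guessLen p m := by
            rw [div_div]
            apply one_div_le_one_div_of_le (by positivity)
            calc (m : ℝ) ^ d * 2 ^ guessLen p m ≤ (m : ℝ) ^ d * (m : ℝ) ^ (kp + 1) :=
                  mul_le_mul_of_nonneg_left (h2L.trans h4P) hpos.le
              _ = (m : ℝ) ^ (d + kp + 1) := by rw [← pow_add, add_assoc]
          linarith
  exact (key.and_eventually hev).exists.elim fun m hm => hm.2 hm.1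

/-- **The two renderings are equivalent.** [cite: VanMelkebeek2000, Thm. 6.2.1] -/
theorem impagliazzoWigderson1998_samplable_iff_printed :
    impagliazzoWigderson1998_samplable ↔ impagliazzoWigderson1998 :=
  ⟨impagliazzoWigderson1998_of_samplable, impagliazzoWigderson1998_samplable_of_printed⟩

end Literature.Computability.Complexity

end
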